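import Summits.SmoothPoincare4.SmoothPoincare4.Theses.ConvexBisection
import Mathlib.Geometry.Manifold.Diffeomorph
import Mathlib.Geometry.Manifold.Immersion
import Literature.Geometry.Symplectic.SteinFillingSphere
import Literature.Topology.FourManifolds.CerfGammaFour
import Literature.Topology.FourManifolds.TwistedSpheres
import Literature.Topology.FourManifolds.CorkDecomposition
import Literature.Topology.FourManifolds.ClosedBall
import Literature.Topology.FourManifolds.Cobordism
import Literature.Topology.FourManifolds.SPC4Wave0
import Literature.AlgebraicTopology.FundamentalGroup.SphereSimplyConnected

/-!
# `SphereSeamStandard` — the seam-`S³` endpoint of route ConvexBisection, conditionally on three named facts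
(item stmt-SmoothPoincare4-10510, route route-SmoothPoincare4-ConvexBisection)

The support item `Summit.SmoothPoincare4.SmoothPoincare4.Theses.ConvexBisection.SphereSeamStandard`:
a (Hausdorff, second countable) smooth `4`-manifold `M ≃ₕ S⁴` which is a Stein bisection
`M = e₁(W₁) ∪ e₂(W₂)` along a common contact seam — two compact Stein domains `(W₁, J₁)`,
`(W₂, J₂)` smoothly embedded, covering `M`, meeting exactly along the images of both boundaries,
with matched pushed-forward complex tangencies — whose seam `∂W₁` is HOMEOMORPHIC to `S³`, is
diffeomorphic to `S⁴`.

This is proved here CONDITIONALLY on the three published theorems it rests on, each a named fact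
(`def … : Prop`) of the tree taken as a leading hypothesis (none is dischargeable at the tree's
current state; all three are theory-sized):

* `Literature.Topology.FourManifolds.nonempty_diffeomorph_of_homeomorph_of_le_three` — uniqueness
  of smooth structures in dimension `≤ 3` (Munkres 1960, Whitehead 1961; Thurston 1997,
  Thm. 3.10.9), used at `n = 3` to upgrade `∂W₁ ≃ₜ S³` to a DIFFEOMORPHISM `∂W₁ ≅ S³` (the item
  holds only a homeomorphism; Eliashberg's theorem is about the smooth `S³`);
* `Literature.Geometry.Symplectic.Eliashberg1990_steinFilling_sphere_three` — Eliashberg (1990),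
  Thm. 5.1 (with Eliashberg 1992, Thm. 2.1.1): a compact Stein domain whose boundary is
  diffeomorphic to `S³` is diffeomorphic to `𝔻⁴`;
* `Literature.Topology.FourManifolds.cerf_twistedSphere_four` — Cerf (1968), `Γ₄ = 0`: every
  twisted sphere `𝔻⁴ ∪_χ 𝔻⁴` is diffeomorphic to `S⁴`.

Proof (`nonempty_diffeomorph_sphere_four_of_steinBisection_of_diffeomorph` — the core, modulo
Eliashberg + Cerf only, for a seam DIFFEOMORPHIC to `S³` — and
`nonempty_diffeomorph_sphere_four_of_steinBisection_sphereSeam`, which adds the smoothing fact and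
does not use `M ≃ₕ S⁴` at all).  (1) `M` is compact (union of two compact images) and the halves are Hausdorff
and second countable (embedded in `M`); take boundary data `b₁`, `b₂`
(`Literature.Topology.FourManifolds.nonempty_boundaryData_holds`).  (2) `b₁.carrier ≃ₜ ∂W₁ ≃ₜ S³`
(`b₁.incl` is an embedding onto `∂W₁`), hence `b₁.carrier ≅ S³` by smoothing uniqueness, hence
`W₁ ≅ 𝔻⁴` by Eliashberg.  (3) The seam map `ψ : b₁.carrier ≅ b₂.carrier`
(`exists_seamDiffeomorph`: `e₂ ∘ incl₂ ∘ ψ = e₁ ∘ incl₁`; a diffeomorphism by the uniqueness of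
the smooth structure of the embedded seam, no contact hypothesis needed) gives
`b₂.carrier ≅ S³`, hence `W₂ ≅ 𝔻⁴` by Eliashberg.  (4) `M = W₁ ∪_ψ W₂` is a boundary gluing (pieces `e₁`, `e₂`; the seam equations say
`e₁ a = e₂ a'` iff `a = incl₁ z`, `a' = incl₂ (ψ z)`).  (5) Transporting along `𝔻⁴ ≅ W₁`,
`𝔻⁴ ≅ W₂` (`Literature.Topology.FourManifolds.IsBoundaryGluing.transfer`) exhibits `M` as a
twisted sphere `𝔻⁴ ∪_χ 𝔻⁴`, and Cerf concludes.  Steps (4)–(5) are the bookkeeping of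
`Theorems/ConvexBisectionContractibleTwistedDoubleStandardStubBallHalf.lean` (line
property-r-mazur-halves of crux ContractibleTwistedDoubleStandard), with Milnor's disc theorem
replaced by smoothing uniqueness + Eliashberg on the first half; the seam lemma is `stub_seam` of
`Theorems/ConvexBisectionContractibleTwistedDoubleStandardStubSeam.lean` minus its contact clause.
The matching of complex tangencies in the item is therefore NOT used (for the seam `S³` it carries
no information: both halves are balls whatever the gluing contactomorphism), so the main theorem
also serves route SymplecticCap's `SteinSplitV2` (Stein|Stein along `S³`, no contact matching).
Variant: `nonempty_diffeomorph_sphere_four_of_steinBisection_sphereSeam'` /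
`sphereSeamStandard_of_facts'` replace the smoothing-uniqueness fact by Perelman's theorem in the
tree's smooth form `Literature.Topology.FourManifolds.nonempty_diffeomorph_sphere_three` (the
abstract seam is a closed simply connected smooth `3`-manifold), so the item is closed modulo
`{Eliashberg1990_steinFilling_sphere_three, cerf_twistedSphere_four}` plus EITHER dimension-`3`
fact; with a seam given as DIFFEOMORPHIC to `S³` (the shape of Eliashberg's fact) no dimension-`3`
fact is needed at all (`…_of_diffeomorph`).

## References

* Ya. Eliashberg, *Filling by holomorphic discs and its applications*, LMS Lecture Note Ser. 151
  (1990), Thm. 5.1. [Eliashberg1990]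
* Ya. Eliashberg, *Contact 3-manifolds twenty years since J. Martinet's work*, Ann. Inst. Fourier
  42 (1992), Thm. 2.1.1. [Eliashberg1992]
* J. Cerf, *Sur les difféomorphismes de la sphère de dimension trois (Γ₄ = 0)*, LNM 53 (1968).
  [CerfDiffeoSphere1968]
* J. Munkres, *Obstructions to the smoothing of piecewise-differentiable homeomorphisms*, Ann. of
  Math. 72 (1960). [Munkres1960]
* M. Kervaire, J. Milnor, *Groups of homotopy spheres I*, Ann. of Math. 77 (1963), §1.
  [KervaireMilnor1963]
* J. Morgan, G. Tian, *Ricci flow and the Poincaré conjecture*, Clay Math. Monographs 3 (2007),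
  Cor. 0.2 (a). [MorganTian2007]
-/

noncomputable section

-- the prescribed namespace `Summit.<P>.<Sub>.…` duplicates `SmoothPoincare4` (P = Sub)
set_option linter.dupNamespace false

open scoped Manifold ContDiff Topology
open Set Function Literature.Topology.FourManifolds Literature.Geometry.Symplectic

namespace Summit.SmoothPoincare4.SmoothPoincare4.Theorems

/-! ### The seam diffeomorphism of a bisection (no contact hypothesis) -/

section Seam

variable {X : Type*} [TopologicalSpace X] [ChartedSpace (EuclideanSpace ℝ (Fin 4)) X]
  {W : Type*} [TopologicalSpace W] [ChartedSpace (EuclideanHalfSpace 4) W]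
  {W' : Type*} [TopologicalSpace W'] [ChartedSpace (EuclideanHalfSpace 4) W']

/-- **Smoothness of a map read through two immersions.**  If `e : W → X` is a smooth embedding,
`b` a boundary datum of `W`, and `ψ : N → b.carrier` is any map with `e ∘ b.incl ∘ ψ = f` smooth,
then `ψ` is smooth: `e ∘ b.incl` is a topological embedding, so `ψ` is continuous, and a
continuous map into the source of an immersion is `C^∞` iff its composite with the immersion is
(Mathlib `ContMDiff.iff_comp_isImmersion`, twice).  Lee, *Introduction to Smooth Manifolds*
(2013), Thm. 5.29 / Cor. 5.30.  (Same argument as the private helper of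
`Theorems/ConvexBisectionContractibleTwistedDoubleStandardStubSeam.lean`.) [folklore] -/
theorem contMDiff_of_comp_incl_eq_of_isSmoothEmbedding {N : Type*} [TopologicalSpace N]
    [ChartedSpace (EuclideanSpace ℝ (Fin 3)) N] {e : W → X}
    (he : Manifold.IsSmoothEmbedding (𝓡∂ 4) (𝓡 4) ∞ e) (b : BoundaryData (𝓡∂ 4) W (𝓡 3))
    {ψ : N → b.carrier} {f : N → X} (hf : ContMDiff (𝓡 3) (𝓡 4) ∞ f)
    (h : ∀ z, e (b.incl (ψ z)) = f z) : ContMDiff (𝓡 3) (𝓡 3) ∞ ψ := by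
  have hcomp : (e ∘ b.incl) ∘ ψ = f := funext h
  have hcomp' : e ∘ (b.incl ∘ ψ) = f := funext h
  have hemb : Topology.IsEmbedding (e ∘ b.incl) :=
    he.isEmbedding.comp b.isSmoothEmbedding.isEmbedding
  have hcont : Continuous ψ := by
    rw [hemb.continuous_iff, hcomp]
    exact hf.continuous
  rw [ContMDiff.iff_comp_isImmersion b.isSmoothEmbedding.isImmersion]
  refine ⟨hcont, ?_⟩
  rw [ContMDiff.iff_comp_isImmersion he.isImmersion, hcomp']
  exact ⟨b.continuous_incl.comp hcont, hf⟩

omit [TopologicalSpace X] [ChartedSpace (EuclideanSpace ℝ (Fin 4)) X] in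
/-- **Seam points come from the abstract boundary of the other half.**  If the images of
`e : W → X` and `e' : W' → X` meet exactly in `e '' ∂W` and exactly in `e' '' ∂W'`, then for
boundary data `b`, `b'` every point `e (b.incl z)` is of the form `e' (b'.incl w)`. [folklore] -/
theorem exists_incl_eq_of_seam_eq {e : W → X} {e' : W' → X}
    (hI : range e ∩ range e' = e '' (𝓡∂ 4).boundary W)
    (hI' : range e ∩ range e' = e' '' (𝓡∂ 4).boundary W')
    (b : BoundaryData (𝓡∂ 4) W (𝓡 3)) (b' : BoundaryData (𝓡∂ 4) W' (𝓡 3)) (z : b.carrier) :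
    ∃ w : b'.carrier, e' (b'.incl w) = e (b.incl z) := by
  have hmem : e (b.incl z) ∈ range e ∩ range e' := by
    rw [hI]
    exact ⟨b.incl z, b.incl_mem_boundary z, rfl⟩
  rw [hI'] at hmem
  obtain ⟨w', hw', hw'e⟩ := hmem
  rw [← b'.range_incl] at hw'
  obtain ⟨w, rfl⟩ := hw'
  exact ⟨w, hw'e⟩

/-- **The seam diffeomorphism of a bisection.**  For two manifolds with boundary `W`, `W'`
(model `𝓡∂ 4`) smoothly embedded in a `4`-manifold `X` so that the images meet exactly along the
images of BOTH boundaries, and any boundary data `b`, `b'`, the seam map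
`ψ = incl'⁻¹ ∘ e'⁻¹ ∘ e ∘ incl : b.carrier → b'.carrier` is a diffeomorphism intertwining the
embeddings, `e' ∘ incl' ∘ ψ = e ∘ incl`.  Set-theoretically `ψ` is forced by injectivity of
`e' ∘ incl'`; smoothness of `ψ`, `ψ⁻¹` is the uniqueness of the smooth structure of the embedded
submanifold `e(∂W) = e'(∂W') ⊂ X` (Lee, *Introduction to Smooth Manifolds* (2013), Thm. 5.29 and
Thm. 5.31).  This is `stub_seam` of `Theorems/ConvexBisectionContractibleTwistedDoubleStandardStubSeam.lean`
WITHOUT its Stein structures and complex-tangency matching (which only serve the contactomorphism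
clause there) and without compactness of `X`. [folklore] -/
theorem exists_seamDiffeomorph {e : W → X} {e' : W' → X}
    (h₁ : Manifold.IsSmoothEmbedding (𝓡∂ 4) (𝓡 4) ∞ e)
    (h₂ : Manifold.IsSmoothEmbedding (𝓡∂ 4) (𝓡 4) ∞ e')
    (hI₁ : range e ∩ range e' = e '' (𝓡∂ 4).boundary W)
    (hI₂ : range e ∩ range e' = e' '' (𝓡∂ 4).boundary W')
    (b₁ : BoundaryData (𝓡∂ 4) W (𝓡 3)) (b₂ : BoundaryData (𝓡∂ 4) W' (𝓡 3)) :
    ∃ ψ : b₁.carrier ≃ₘ⟮𝓡 3, 𝓡 3⟯ b₂.carrier, ∀ z, e' (b₂.incl (ψ z)) = e (b₁.incl z) := by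
  -- the seam map and its inverse, set-theoretically
  have hex₁ : ∀ z : b₁.carrier, ∃ w : b₂.carrier, e' (b₂.incl w) = e (b₁.incl z) :=
    exists_incl_eq_of_seam_eq hI₁ hI₂ b₁ b₂
  have hex₂ : ∀ w : b₂.carrier, ∃ z : b₁.carrier, e (b₁.incl z) = e' (b₂.incl w) := by
    intro w
    have hI₁' : range e' ∩ range e = e' '' (𝓡∂ 4).boundary W' := by rw [inter_comm]; exact hI₂
    have hI₂' : range e' ∩ range e = e '' (𝓡∂ 4).boundary W := by rw [inter_comm]; exact hI₁
    exact exists_incl_eq_of_seam_eq hI₁' hI₂' b₂ b₁ w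
  choose ψ hψ using hex₁
  choose φ hφ using hex₂
  have hinj₁ : Injective (e ∘ b₁.incl) := h₁.isEmbedding.injective.comp b₁.injective_incl
  have hinj₂ : Injective (e' ∘ b₂.incl) := h₂.isEmbedding.injective.comp b₂.injective_incl
  have hleft : ∀ z, φ (ψ z) = z := fun z => hinj₁ (by
    show e (b₁.incl (φ (ψ z))) = e (b₁.incl z)
    rw [hφ, hψ])
  have hright : ∀ w, ψ (φ w) = w := fun w => hinj₂ (by
    show e' (b₂.incl (ψ (φ w))) = e' (b₂.incl w)
    rw [hψ, hφ])
  -- smoothness of `ψ` and `φ` through the immersions `incl` and `e`, `e'`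
  have hψs : ContMDiff (𝓡 3) (𝓡 3) ∞ ψ :=
    contMDiff_of_comp_incl_eq_of_isSmoothEmbedding h₂ b₂
      (h₁.contMDiff.comp b₁.isSmoothEmbedding.contMDiff) hψ
  have hφs : ContMDiff (𝓡 3) (𝓡 3) ∞ φ :=
    contMDiff_of_comp_incl_eq_of_isSmoothEmbedding h₁ b₁
      (h₂.contMDiff.comp b₂.isSmoothEmbedding.contMDiff) hφ
  exact ⟨{ toFun := ψ, invFun := φ, left_inv := hleft, right_inv := hright,
           contMDiff_toFun := hψs, contMDiff_invFun := hφs }, hψ⟩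

end Seam

/-! ### The bisection theorems -/

/-- **A Stein bisection whose first half is bounded by a smooth `S³` is `S⁴`** (conditionally on
Eliashberg 1990 Thm. 5.1 and Cerf 1968 `Γ₄ = 0` only).  Let `M` be a Hausdorff second countable
smooth `4`-manifold covered by two smoothly embedded compact Stein domains `(W₁, J₁)`, `(W₂, J₂)`
meeting exactly along the images of both boundaries, and suppose some boundary datum `b₁` of `W₁`
has carrier DIFFEOMORPHIC to the round `S³`.  Then `M ≅ S⁴`: `W₁ ≅ 𝔻⁴` (Eliashberg); the seam
diffeomorphism `ψ : ∂W₁ ≅ ∂W₂` (`exists_seamDiffeomorph`) gives `∂W₂ ≅ S³`, so `W₂ ≅ 𝔻⁴`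
(Eliashberg); `M = W₁ ∪_ψ W₂` (pieces `e₁`, `e₂`) transported along the two ball diffeomorphisms
(`IsBoundaryGluing.transfer`) is a twisted sphere `𝔻⁴ ∪_χ 𝔻⁴ ≅ S⁴` (Cerf).  Neither a homotopy
hypothesis on `M` nor any compatibility of `J₁`, `J₂` along the seam is needed.  This is the
form matching the hypothesis of `Eliashberg1990_steinFilling_sphere_three`; the homeomorphic-seam
forms below add one smoothing fact.  Kervaire–Milnor (1963), §1; Eliashberg (1990), Thm. 5.1;
Cerf (1968). [cite: Eliashberg1990, Thm. 5.1] [cite: KervaireMilnor1963, §1] -/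
theorem nonempty_diffeomorph_sphere_four_of_steinBisection_of_diffeomorph
    (hE : Eliashberg1990_steinFilling_sphere_three) (hCerf : cerf_twistedSphere_four)
    (M : Type) [TopologicalSpace M] [T2Space M] [SecondCountableTopology M]
    [ChartedSpace (EuclideanSpace ℝ (Fin 4)) M] [IsManifold (𝓡 4) ∞ M]
    (W₁ : Type) [TopologicalSpace W₁] [ChartedSpace (EuclideanHalfSpace 4) W₁]
    [IsManifold (𝓡∂ 4) ∞ W₁] [CompactSpace W₁]
    (W₂ : Type) [TopologicalSpace W₂] [ChartedSpace (EuclideanHalfSpace 4) W₂]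
    [IsManifold (𝓡∂ 4) ∞ W₂] [CompactSpace W₂]
    (J₁ : SteinStructure W₁) (J₂ : SteinStructure W₂) (e₁ : W₁ → M) (e₂ : W₂ → M)
    (h1 : Manifold.IsSmoothEmbedding (𝓡∂ 4) (𝓡 4) ∞ e₁)
    (h2 : Manifold.IsSmoothEmbedding (𝓡∂ 4) (𝓡 4) ∞ e₂)
    (hcov : Set.range e₁ ∪ Set.range e₂ = Set.univ)
    (hL : Set.range e₁ ∩ Set.range e₂ = e₁ '' (𝓡∂ 4).boundary W₁)
    (hR : Set.range e₁ ∩ Set.range e₂ = e₂ '' (𝓡∂ 4).boundary W₂)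
    (b₁ : BoundaryData (𝓡∂ 4) W₁ (𝓡 3))
    (Θ₁ : b₁.carrier ≃ₘ⟮𝓡 3, 𝓡 3⟯ Metric.sphere (0 : EuclideanSpace ℝ (Fin 4)) 1) :
    Nonempty (M ≃ₘ⟮𝓡 4, 𝓡 4⟯ Metric.sphere (0 : EuclideanSpace ℝ (Fin 5)) 1) := by
  -- (1) `M` is compact; the halves are Hausdorff and second countable; boundary datum of `W₂`
  haveI : CompactSpace M := ⟨by
    rw [← hcov]
    exact (isCompact_range h1.isEmbedding.continuous).union
      (isCompact_range h2.isEmbedding.continuous)⟩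
  haveI : T2Space W₁ := h1.isEmbedding.t2Space
  haveI : T2Space W₂ := h2.isEmbedding.t2Space
  haveI : SecondCountableTopology W₁ := h1.isEmbedding.secondCountableTopology
  haveI : SecondCountableTopology W₂ := h2.isEmbedding.secondCountableTopology
  obtain ⟨b₂⟩ : Nonempty (BoundaryData (𝓡∂ 4) W₂ (𝓡 3)) := nonempty_boundaryData_holds 3 W₂
  -- (2) `W₁ ≅ 𝔻⁴` (Eliashberg)
  obtain ⟨Φ₁⟩ := hE.of_steinStructure J₁ b₁ Θ₁
  -- (3) the seam diffeomorphism and `W₂ ≅ 𝔻⁴` (Eliashberg)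
  obtain ⟨ψ, hψ⟩ := exists_seamDiffeomorph h1 h2 hL hR b₁ b₂
  obtain ⟨Φ₂⟩ := hE.of_steinStructure J₂ b₂ (ψ.symm.trans Θ₁)
  -- (4) `M = W₁ ∪_ψ W₂`
  have hglue : IsBoundaryGluing b₁ b₂ ψ (𝓡 4) M := by
    refine ⟨e₁, e₂, h1, h2, hcov, fun a a' => ⟨fun h => ?_, ?_⟩⟩
    · have hp : e₁ a ∈ range e₁ ∩ range e₂ := ⟨mem_range_self _, h ▸ mem_range_self _⟩
      rw [hL] at hp
      obtain ⟨w, hw, hww⟩ := hp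
      have hb : a ∈ (𝓡∂ 4).boundary W₁ := by rwa [← h1.isEmbedding.injective hww]
      have ha : a ∈ range b₁.incl := by rw [b₁.range_incl]; exact hb
      obtain ⟨z, rfl⟩ := ha
      refine ⟨z, rfl, h2.isEmbedding.injective ?_⟩
      rw [hψ z]
      exact h.symm
    · rintro ⟨z, rfl, rfl⟩
      exact (hψ z).symm
  -- (5) transport to the two balls: `M = 𝔻⁴ ∪_χ 𝔻⁴`, and Cerf
  let D : BoundaryData (𝓡∂ 4) (Metric.closedBall (0 : EuclideanSpace ℝ (Fin 4)) 1) (𝓡 3) :=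
    closedBallBoundaryData 3
  have hT₁ : IsBoundaryGluing D b₂ (ψ ∘ D.restrictDiffeomorph b₁ Φ₁.symm) (𝓡 4) M :=
    IsBoundaryGluing.transfer (b₁ := D) Φ₁.symm hglue
  have hT₁' : IsBoundaryGluing D b₂ ⇑((D.restrictDiffeomorph b₁ Φ₁.symm).trans ψ) (𝓡 4) M := hT₁
  have hT₂ : IsBoundaryGluing D D
      (⇑((D.restrictDiffeomorph b₁ Φ₁.symm).trans ψ).symm ∘ D.restrictDiffeomorph b₂ Φ₂.symm)
      (𝓡 4) M :=
    IsBoundaryGluing.transfer (b₁ := D) Φ₂.symm hT₁'.symm'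
  let χ : (Metric.sphere (0 : EuclideanSpace ℝ (Fin 4)) 1) ≃ₘ⟮𝓡 3, 𝓡 3⟯
      (Metric.sphere (0 : EuclideanSpace ℝ (Fin 4)) 1) :=
    (D.restrictDiffeomorph b₂ Φ₂.symm).trans ((D.restrictDiffeomorph b₁ Φ₁.symm).trans ψ).symm
  have hX : IsTwistedSphere 3 χ M := hT₂
  let T : TwistedSphere 3 χ := { carrier := M, isTwistedSphere := hX }
  exact hCerf χ T

/-- **A Stein bisection with seam homeomorphic to `S³` is `S⁴`** (conditionally on smoothing
uniqueness in dimension `3`, Eliashberg 1990 Thm. 5.1 and Cerf 1968 `Γ₄ = 0`).  Let `M` be a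
Hausdorff second countable smooth `4`-manifold covered by two smoothly embedded compact Stein
domains `(W₁, J₁)`, `(W₂, J₂)` meeting exactly along the images of both boundaries, and suppose
`∂W₁ ≃ₜ S³`.  Then `M ≅ S⁴`: for a boundary datum `b₁` of `W₁`
(`nonempty_boundaryData_holds`), `b₁.carrier ≃ₜ ∂W₁ ≃ₜ S³` (`b₁.incl` is an embedding onto
`∂W₁`), hence `b₁.carrier ≅ S³` smoothly by the uniqueness of smooth structures in dimension `3`
(Munkres 1960 / Whitehead 1961, the fact `nonempty_diffeomorph_of_homeomorph_of_le_three` at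
`n = 3`), and `nonempty_diffeomorph_sphere_four_of_steinBisection_of_diffeomorph` concludes.
Neither a homotopy hypothesis on `M` nor any compatibility of `J₁`, `J₂` along the seam is
needed.  Kervaire–Milnor (1963), §1; Eliashberg (1990), Thm. 5.1; Cerf (1968).
[cite: Eliashberg1990, Thm. 5.1] [cite: KervaireMilnor1963, §1] -/
theorem nonempty_diffeomorph_sphere_four_of_steinBisection_sphereSeam
    (hU : nonempty_diffeomorph_of_homeomorph_of_le_three.{0, 0})
    (hE : Eliashberg1990_steinFilling_sphere_three) (hCerf : cerf_twistedSphere_four)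
    (M : Type) [TopologicalSpace M] [T2Space M] [SecondCountableTopology M]
    [ChartedSpace (EuclideanSpace ℝ (Fin 4)) M] [IsManifold (𝓡 4) ∞ M]
    (W₁ : Type) [TopologicalSpace W₁] [ChartedSpace (EuclideanHalfSpace 4) W₁]
    [IsManifold (𝓡∂ 4) ∞ W₁] [CompactSpace W₁]
    (W₂ : Type) [TopologicalSpace W₂] [ChartedSpace (EuclideanHalfSpace 4) W₂]
    [IsManifold (𝓡∂ 4) ∞ W₂] [CompactSpace W₂]
    (J₁ : SteinStructure W₁) (J₂ : SteinStructure W₂) (e₁ : W₁ → M) (e₂ : W₂ → M)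
    (h1 : Manifold.IsSmoothEmbedding (𝓡∂ 4) (𝓡 4) ∞ e₁)
    (h2 : Manifold.IsSmoothEmbedding (𝓡∂ 4) (𝓡 4) ∞ e₂)
    (hcov : Set.range e₁ ∪ Set.range e₂ = Set.univ)
    (hL : Set.range e₁ ∩ Set.range e₂ = e₁ '' (𝓡∂ 4).boundary W₁)
    (hR : Set.range e₁ ∩ Set.range e₂ = e₂ '' (𝓡∂ 4).boundary W₂)
    (θ : ((𝓡∂ 4).boundary W₁) ≃ₜ Metric.sphere (0 : EuclideanSpace ℝ (Fin 4)) 1) :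
    Nonempty (M ≃ₘ⟮𝓡 4, 𝓡 4⟯ Metric.sphere (0 : EuclideanSpace ℝ (Fin 5)) 1) := by
  -- `W₁` is Hausdorff and second countable (embedded in `M`); a boundary datum
  haveI : T2Space W₁ := h1.isEmbedding.t2Space
  haveI : SecondCountableTopology W₁ := h1.isEmbedding.secondCountableTopology
  obtain ⟨b₁⟩ : Nonempty (BoundaryData (𝓡∂ 4) W₁ (𝓡 3)) := nonempty_boundaryData_holds 3 W₁
  -- `b₁.carrier ≃ₜ ∂W₁ ≃ₜ S³`, hence `≅ S³` (smoothing uniqueness)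
  have θ₁ : b₁.carrier ≃ₜ Metric.sphere (0 : EuclideanSpace ℝ (Fin 4)) 1 :=
    (b₁.isSmoothEmbedding.isEmbedding.toHomeomorph.trans
      (Homeomorph.setCongr b₁.range_incl)).trans θ
  haveI : T2Space b₁.carrier := b₁.isSmoothEmbedding.isEmbedding.t2Space
  haveI : SecondCountableTopology b₁.carrier :=
    b₁.isSmoothEmbedding.isEmbedding.secondCountableTopology
  obtain ⟨Θ₁⟩ := hU 3 le_rfl b₁.carrier (Metric.sphere (0 : EuclideanSpace ℝ (Fin 4)) 1) θ₁
  exact nonempty_diffeomorph_sphere_four_of_steinBisection_of_diffeomorph hE hCerf M W₁ W₂ J₁ J₂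
    e₁ e₂ h1 h2 hcov hL hR b₁ Θ₁

/-- **A Stein bisection with seam homeomorphic to `S³` is `S⁴` — variant over Perelman's theorem**
(conditionally on the smooth 3-dimensional Poincaré conjecture, Eliashberg 1990 Thm. 5.1 and
Cerf 1968 `Γ₄ = 0`).  Same statement as
`nonempty_diffeomorph_sphere_four_of_steinBisection_sphereSeam`, with the smoothing-uniqueness
fact replaced by `nonempty_diffeomorph_sphere_three` (Perelman; Morgan–Tian 2007, Cor. 0.2 (a):
a closed simply connected smooth `3`-manifold is diffeomorphic to `S³`): the abstract boundary
`b₁.carrier ≃ₜ S³` is compact and simply connected (`π₁(S³) = 1`,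
`Literature.AlgebraicTopology.FundamentalGroup.simplyConnectedSpace_euclideanSphere`, transported along the
homeomorphism), hence diffeomorphic to `S³`, and
`nonempty_diffeomorph_sphere_four_of_steinBisection_of_diffeomorph` concludes.  Recorded so that
the item is closed modulo `{Eliashberg, Cerf}` plus EITHER of the two dimension-`3` facts of the
tree. [cite: MorganTian2007, Cor. 0.2 (a)] [cite: Eliashberg1990, Thm. 5.1] -/
theorem nonempty_diffeomorph_sphere_four_of_steinBisection_sphereSeam'
    (hP : nonempty_diffeomorph_sphere_three.{0})
    (hE : Eliashberg1990_steinFilling_sphere_three) (hCerf : cerf_twistedSphere_four)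
    (M : Type) [TopologicalSpace M] [T2Space M] [SecondCountableTopology M]
    [ChartedSpace (EuclideanSpace ℝ (Fin 4)) M] [IsManifold (𝓡 4) ∞ M]
    (W₁ : Type) [TopologicalSpace W₁] [ChartedSpace (EuclideanHalfSpace 4) W₁]
    [IsManifold (𝓡∂ 4) ∞ W₁] [CompactSpace W₁]
    (W₂ : Type) [TopologicalSpace W₂] [ChartedSpace (EuclideanHalfSpace 4) W₂]
    [IsManifold (𝓡∂ 4) ∞ W₂] [CompactSpace W₂]
    (J₁ : SteinStructure W₁) (J₂ : SteinStructure W₂) (e₁ : W₁ → M) (e₂ : W₂ → M)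
    (h1 : Manifold.IsSmoothEmbedding (𝓡∂ 4) (𝓡 4) ∞ e₁)
    (h2 : Manifold.IsSmoothEmbedding (𝓡∂ 4) (𝓡 4) ∞ e₂)
    (hcov : Set.range e₁ ∪ Set.range e₂ = Set.univ)
    (hL : Set.range e₁ ∩ Set.range e₂ = e₁ '' (𝓡∂ 4).boundary W₁)
    (hR : Set.range e₁ ∩ Set.range e₂ = e₂ '' (𝓡∂ 4).boundary W₂)
    (θ : ((𝓡∂ 4).boundary W₁) ≃ₜ Metric.sphere (0 : EuclideanSpace ℝ (Fin 4)) 1) :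
    Nonempty (M ≃ₘ⟮𝓡 4, 𝓡 4⟯ Metric.sphere (0 : EuclideanSpace ℝ (Fin 5)) 1) := by
  -- `W₁` is Hausdorff and second countable (embedded in `M`); a boundary datum
  haveI : T2Space W₁ := h1.isEmbedding.t2Space
  haveI : SecondCountableTopology W₁ := h1.isEmbedding.secondCountableTopology
  obtain ⟨b₁⟩ : Nonempty (BoundaryData (𝓡∂ 4) W₁ (𝓡 3)) := nonempty_boundaryData_holds 3 W₁
  -- `b₁.carrier ≃ₜ S³` is a closed simply connected smooth `3`-manifold, hence `≅ S³` (Perelman)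
  have θ₁ : b₁.carrier ≃ₜ Metric.sphere (0 : EuclideanSpace ℝ (Fin 4)) 1 :=
    (b₁.isSmoothEmbedding.isEmbedding.toHomeomorph.trans
      (Homeomorph.setCongr b₁.range_incl)).trans θ
  haveI : T2Space b₁.carrier := b₁.isSmoothEmbedding.isEmbedding.t2Space
  haveI : SecondCountableTopology b₁.carrier :=
    b₁.isSmoothEmbedding.isEmbedding.secondCountableTopology
  haveI : CompactSpace b₁.carrier := θ₁.symm.compactSpace
  haveI : SimplyConnectedSpace (Metric.sphere (0 : EuclideanSpace ℝ (Fin 4)) 1) :=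
    Literature.AlgebraicTopology.FundamentalGroup.simplyConnectedSpace_euclideanSphere 3
      (by norm_num)
  haveI : SimplyConnectedSpace b₁.carrier := θ₁.toHomotopyEquiv.simplyConnectedSpace
  obtain ⟨Θ₁⟩ := hP b₁.carrier
  exact nonempty_diffeomorph_sphere_four_of_steinBisection_of_diffeomorph hE hCerf M W₁ W₂ J₁ J₂
    e₁ e₂ h1 h2 hcov hL hR b₁ Θ₁

/-- **`SphereSeamStandard` modulo smoothing uniqueness (`n ≤ 3`), Eliashberg (1990) Thm. 5.1
and Cerf (1968) `Γ₄ = 0`.**  The support item of route ConvexBisection — a homotopy `4`-sphere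
with a Stein bisection along a common contact seam homeomorphic to `S³` is diffeomorphic to
`S⁴` — follows from the three named facts by
`nonempty_diffeomorph_sphere_four_of_steinBisection_sphereSeam`; the homotopy equivalence
`M ≃ₕ S⁴` and the matching of complex tangencies are not used.  CONDITIONAL result: the item's own signature is the conclusion, the
three hypotheses are undischarged published theorems of the tree
(`Literature.Topology.FourManifolds.nonempty_diffeomorph_of_homeomorph_of_le_three`,
`Literature.Geometry.Symplectic.Eliashberg1990_steinFilling_sphere_three`,
`Literature.Topology.FourManifolds.cerf_twistedSphere_four`).
[cite: Eliashberg1990, Thm. 5.1] [cite: KervaireMilnor1963, §1] -/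
theorem sphereSeamStandard_of_facts
    (hU : nonempty_diffeomorph_of_homeomorph_of_le_three.{0, 0})
    (hE : Eliashberg1990_steinFilling_sphere_three) (hCerf : cerf_twistedSphere_four) :
    Summit.SmoothPoincare4.SmoothPoincare4.Theses.ConvexBisection.SphereSeamStandard := by
  intro M _ _ _ _ _ _ hyp
  obtain ⟨W₁, _, _, _, _, W₂, _, _, _, _, J₁, J₂, e₁, e₂, h1, h2, hcov, hL, hR, -, ⟨θ⟩⟩ := hyp
  exact nonempty_diffeomorph_sphere_four_of_steinBisection_sphereSeam hU hE hCerf M W₁ W₂ J₁ J₂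
    e₁ e₂ h1 h2 hcov hL hR θ

/-- **`SphereSeamStandard` modulo the smooth 3-dimensional Poincaré conjecture (Perelman),
Eliashberg (1990) Thm. 5.1 and Cerf (1968) `Γ₄ = 0`** — the variant of
`sphereSeamStandard_of_facts` over `nonempty_diffeomorph_sphere_four_of_steinBisection_sphereSeam'`,
trading the smoothing-uniqueness fact for `nonempty_diffeomorph_sphere_three`.  CONDITIONAL
result (three undischarged named facts of the tree).
[cite: MorganTian2007, Cor. 0.2 (a)] [cite: Eliashberg1990, Thm. 5.1] -/
theorem sphereSeamStandard_of_facts'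
    (hP : nonempty_diffeomorph_sphere_three.{0})
    (hE : Eliashberg1990_steinFilling_sphere_three) (hCerf : cerf_twistedSphere_four) :
    Summit.SmoothPoincare4.SmoothPoincare4.Theses.ConvexBisection.SphereSeamStandard := by
  intro M _ _ _ _ _ _ hyp
  obtain ⟨W₁, _, _, _, _, W₂, _, _, _, _, J₁, J₂, e₁, e₂, h1, h2, hcov, hL, hR, -, ⟨θ⟩⟩ := hyp
  exact nonempty_diffeomorph_sphere_four_of_steinBisection_sphereSeam' hP hE hCerf M W₁ W₂ J₁ J₂
    e₁ e₂ h1 h2 hcov hL hR θ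

end Summit.SmoothPoincare4.SmoothPoincare4.Theorems

end
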